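/-
COR-CM (cell pub-hodgecm2, stage 2 of the Hodge ladder) — count-neutral, INTRINSIC (generator) form of the degree-14 census
transport (seat prover-pub-hodgecm2-b23-g35-0, binder prover b23, gen 35; claim DEG16-CYCLIC; sequel of
`Census/HexadecicFaceTransportCyclic.lean` and `CorCM/FaceCensusGroupDictionary.lean`, pattern of
`Census/CyclicFaceTransportIntrinsic.lean` (ℤ/8, ℤ/10, ℤ/12) and `TetradecicFaceTransportCyclicIntrinsic.lean`). Theorems only:
the dictionary binders (`ε`, `hε`, `ε c = Γ.conj`) of the automorphism form are DERIVED from ONE generator of `Aut(K)` and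
`finrank ℚ K = 16`; the fifteen faces are read as `g`-power data; the closed field-closure theorem follows. No definition, no
named fact, nothing asserted; `Interfaces.lean` (C1), every E term, B01 and `Transposition/*` are untouched. HONEST FRAMING
(COORDINATOR RULING — HODGE FRAMING CORRECTION, 2026-08-21T11:55:35Z): `HC_CM` is NOT proved, here or anywhere in the tree; the
headline is CONDITIONAL on fifteen face periods for ONE field.
T5 (coordinator ruling 15:33:56Z (3)): binder set of the headline = {`finrank ℚ K = 16` + a generator `g` of `Aut(K)` (inhabited by
every cyclic CM field of degree 16), fifteen face descriptions (inhabited: `exists_face_of_generator_*`), fifteen face periods = instances of the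
crux (`FacePeriodExists` / B01-S) with no `¬` theorem in the tree on the universe of record} — no contradiction derivable; checker: self
(prover-pub-hodgecm2-b23-g35-0), 2026-08-22.
-/
import Summits.HodgeConjecture.CorCM.Census.HexadecicFaceTransportCyclicGenerator
import HarnessLib

/-!
# Degree 16, cyclic type `ℤ/16`: the field closure from ONE generator and fifteen face periods (intrinsic form)

What a field seat supplies NOW for a cyclic CM field `K` of degree 16 (e.g. `ℚ(ζ₁₇)`): `hK : finrank ℚ K = 16`, a generator `g` of
`K ≃ₐ[ℚ] K` (`∀ x, x ∈ Subgroup.zpowers g`), a base embedding `σ₀`, the fifteen faces described by `g`-powers (base type by its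
exponent set, place representatives `σ₀ ∘ g ^ a`, `σ₀ ∘ g ^ b`), and ONE period witness per face on the universe of record.
Complex conjugation at `σ₀` is `g ^ 8` automatically (the unique involution), so no conjugation hypothesis appears. Output: the
Hodge conjecture for every complex abelian variety dominated by a finite product of CM abelian varieties with CM types of
subfields of `K`. `HC_CM` is NOT proved; nothing here produces a period.

References: [cite: Pohlmann1968, Thm. 1]; [cite: Milne1999LefschetzClasses, Thm. 3.2 and Cor. 4.5];
[cite: Shimura1998, §6.2 Theorem 3 and §6.1 Corollary of Theorem 2 (pp. 41–43)]; [cite: MumfordAV1970, §19 Thm. 1 and p. 169].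
-/

noncomputable section

open CategoryTheory NumberField NumberField.ComplexEmbedding
open Literature.AlgebraicGeometry Literature.AlgebraicGeometry.Motives Literature.AlgebraicGeometry.HodgeTheory
open Literature.AlgebraicGeometry.ComplexMultiplication Literature.AlgebraicGeometry.Milne1999
open Literature.NumberTheory.Automorphic
open Literature.NumberTheory.Automorphic.PicardCM
open Summit.HodgeConjecture.CorCM.Domination

namespace Summit.HodgeConjecture.CorCM.HexadecicFaceTransport.Cyclic

open Summit.HodgeConjecture.CorCM.Census.FaceSquaresModel (mem)
open Summit.HodgeConjecture.CorCM.Census.HexadecicFaceGeneratorsCyclic (Γ enum group_spec)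

/-- **FIELD CLOSURE FROM ONE GENERATOR, type `ℤ/16` (`ℚ(ζ₁₇)` and every cyclic CM field of degree 16) — CLOSED, headline.**  `K` a
Galois CM field of degree `16` (its Galois group is then cyclic) with a generator `g` of `Aut(K)`; `σ₀` a base embedding; `Φ_T` (T = 255, 765,
1275, 2295, 2805, 4845) CM types of `K` reading, on `σ₀ ∘ g ^ k`, as the listed exponent sets (they exist: `exists_face_of_generator_*`); the
FIFTEEN faces `R₁ = (Φ_{255}; σ₀∘g^0, σ₀∘g^5)`; `R₂ = (Φ_{255}; σ₀∘g^1, σ₀∘g^6)`; `R₃ = (Φ_{255}; σ₀∘g^4, σ₀∘g^5)`; `R₄ = (Φ_{765}; σ₀∘g^2, σ₀∘g^4)`; `R₅ = (Φ_{765}; σ₀∘g^2, σ₀∘g^7)`; `R₆ = (Φ_{765}; σ₀∘g^4, σ₀∘g^6)`; `R₇ = (Φ_{1275}; σ₀∘g^1, σ₀∘g^3)`; `R₈ = (Φ_{1275}; σ₀∘g^1, σ₀∘g^4)`; `R₉ = (Φ_{1275}; σ₀∘g^3, σ₀∘g^4)`; `R₁₀ = (Φ_{1275}; σ₀∘g^4,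 σ₀∘g^5)`; `R₁₁ = (Φ_{1275}; σ₀∘g^5, σ₀∘g^6)`; `R₁₂ = (Φ_{2295}; σ₀∘g^4, σ₀∘g^7)`; `R₁₃ = (Φ_{2805}; σ₀∘g^6, σ₀∘g^7)`; `R₁₄ = (Φ_{4845}; σ₀∘g^3, σ₀∘g^5)`; `R₁₅ = (Φ_{4845}; σ₀∘g^3, σ₀∘g^7)`.  ONE period witness for each on the universe of record implies the Hodge conjecture, in every codimension, for every
complex abelian variety dominated by a finite product of abelian varieties realising CM types of CM fields embeddable in `K` (products of the
sixteen simple CM eightfolds split by `K`; their powers are unconditional by b04ʼs `CyclicTwoPower*`).  No enumeration, table or conjugation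
hypothesis is left.  (FRAMING: conditional on these fifteen face periods — μ(ℤ/16) = 15 is minimal by the character count of
`HOME/pub-hodgecm2-b23/CYCLIC-MU.md`; `HC_CM` is NOT proved.) [cite: Shimura1998, §6.2 Theorem 3 and §6.1 Corollary of Theorem 2 (pp. 41–43)]
[cite: Pohlmann1968, Thm. 1] [cite: Milne1999LefschetzClasses, Thm. 3.2 and Cor. 4.5] [cite: MumfordAV1970, §19 Thm. 1 and p. 169] -/
theorem hodgeConjectureFor_of_avDominatedBy_isProductOf_of_facePeriod_hexadecicCyclic_gen (K : CMField) [IsGalois ℚ K]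
    (hK : Module.finrank ℚ (K : Type) = 16) {g : ((K : Type) ≃ₐ[ℚ] (K : Type))} (hg : ∀ x, x ∈ Subgroup.zpowers g)
    (σ₀ : (K : Type) →+* ℂ) (R₁ R₂ R₃ R₄ R₅ R₆ R₇ R₈ R₉ R₁₀ R₁₁ R₁₂ R₁₃ R₁₄ R₁₅ : Face K)
    (hΦ₁ : ∀ k : Fin 16, σ₀.comp ((g ^ (k : ℕ) : ((K : Type) ≃ₐ[ℚ] (K : Type))) : (K : Type) →+* (K : Type)) ∈ R₁.Φ.1 ↔ (k : ℕ) < 8)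
    (hp₁ : R₁.p = σ₀.comp ((g ^ (0 : ℕ) : ((K : Type) ≃ₐ[ℚ] (K : Type))) : (K : Type) →+* (K : Type))) (hq₁ : R₁.p' = σ₀.comp ((g ^ (5 : ℕ) : ((K : Type) ≃ₐ[ℚ] (K : Type))) : (K : Type) →+* (K : Type)))
    (hΦ₂ : ∀ k : Fin 16, σ₀.comp ((g ^ (k : ℕ) : ((K : Type) ≃ₐ[ℚ] (K : Type))) : (K : Type) →+* (K : Type)) ∈ R₂.Φ.1 ↔ (k : ℕ) < 8)
    (hp₂ : R₂.p = σ₀.comp ((g ^ (1 : ℕ) : ((K : Type) ≃ₐ[ℚ] (K : Type))) : (K : Type) →+* (K : Type))) (hq₂ : R₂.p' = σ₀.comp ((g ^ (6 : ℕ) : ((K : Type) ≃ₐ[ℚ] (K : Type))) : (K : Type) →+* (K : Type)))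
    (hΦ₃ : ∀ k : Fin 16, σ₀.comp ((g ^ (k : ℕ) : ((K : Type) ≃ₐ[ℚ] (K : Type))) : (K : Type) →+* (K : Type)) ∈ R₃.Φ.1 ↔ (k : ℕ) < 8)
    (hp₃ : R₃.p = σ₀.comp ((g ^ (4 : ℕ) : ((K : Type) ≃ₐ[ℚ] (K : Type))) : (K : Type) →+* (K : Type))) (hq₃ : R₃.p' = σ₀.comp ((g ^ (5 : ℕ) : ((K : Type) ≃ₐ[ℚ] (K : Type))) : (K : Type) →+* (K : Type)))
    (hΦ₄ : ∀ k : Fin 16, σ₀.comp ((g ^ (k : ℕ) : ((K : Type) ≃ₐ[ℚ] (K : Type))) : (K : Type) →+* (K : Type)) ∈ R₄.Φ.1 ↔ k ∈ ({0, 2, 3, 4, 5, 6, 7, 9} : Finset (Fin 16)))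
    (hp₄ : R₄.p = σ₀.comp ((g ^ (2 : ℕ) : ((K : Type) ≃ₐ[ℚ] (K : Type))) : (K : Type) →+* (K : Type))) (hq₄ : R₄.p' = σ₀.comp ((g ^ (4 : ℕ) : ((K : Type) ≃ₐ[ℚ] (K : Type))) : (K : Type) →+* (K : Type)))
    (hΦ₅ : ∀ k : Fin 16, σ₀.comp ((g ^ (k : ℕ) : ((K : Type) ≃ₐ[ℚ] (K : Type))) : (K : Type) →+* (K : Type)) ∈ R₅.Φ.1 ↔ k ∈ ({0, 2, 3, 4, 5, 6, 7, 9} : Finset (Fin 16)))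
    (hp₅ : R₅.p = σ₀.comp ((g ^ (2 : ℕ) : ((K : Type) ≃ₐ[ℚ] (K : Type))) : (K : Type) →+* (K : Type))) (hq₅ : R₅.p' = σ₀.comp ((g ^ (7 : ℕ) : ((K : Type) ≃ₐ[ℚ] (K : Type))) : (K : Type) →+* (K : Type)))
    (hΦ₆ : ∀ k : Fin 16, σ₀.comp ((g ^ (k : ℕ) : ((K : Type) ≃ₐ[ℚ] (K : Type))) : (K : Type) →+* (K : Type)) ∈ R₆.Φ.1 ↔ k ∈ ({0, 2, 3, 4, 5, 6, 7, 9} : Finset (Fin 16)))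
    (hp₆ : R₆.p = σ₀.comp ((g ^ (4 : ℕ) : ((K : Type) ≃ₐ[ℚ] (K : Type))) : (K : Type) →+* (K : Type))) (hq₆ : R₆.p' = σ₀.comp ((g ^ (6 : ℕ) : ((K : Type) ≃ₐ[ℚ] (K : Type))) : (K : Type) →+* (K : Type)))
    (hΦ₇ : ∀ k : Fin 16, σ₀.comp ((g ^ (k : ℕ) : ((K : Type) ≃ₐ[ℚ] (K : Type))) : (K : Type) →+* (K : Type)) ∈ R₇.Φ.1 ↔ k ∈ ({0, 1, 3, 4, 5, 6, 7, 10} : Finset (Fin 16)))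
    (hp₇ : R₇.p = σ₀.comp ((g ^ (1 : ℕ) : ((K : Type) ≃ₐ[ℚ] (K : Type))) : (K : Type) →+* (K : Type))) (hq₇ : R₇.p' = σ₀.comp ((g ^ (3 : ℕ) : ((K : Type) ≃ₐ[ℚ] (K : Type))) : (K : Type) →+* (K : Type)))
    (hΦ₈ : ∀ k : Fin 16, σ₀.comp ((g ^ (k : ℕ) : ((K : Type) ≃ₐ[ℚ] (K : Type))) : (K : Type) →+* (K : Type)) ∈ R₈.Φ.1 ↔ k ∈ ({0, 1, 3, 4, 5, 6, 7, 10} : Finset (Fin 16)))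
    (hp₈ : R₈.p = σ₀.comp ((g ^ (1 : ℕ) : ((K : Type) ≃ₐ[ℚ] (K : Type))) : (K : Type) →+* (K : Type))) (hq₈ : R₈.p' = σ₀.comp ((g ^ (4 : ℕ) : ((K : Type) ≃ₐ[ℚ] (K : Type))) : (K : Type) →+* (K : Type)))
    (hΦ₉ : ∀ k : Fin 16, σ₀.comp ((g ^ (k : ℕ) : ((K : Type) ≃ₐ[ℚ] (K : Type))) : (K : Type) →+* (K : Type)) ∈ R₉.Φ.1 ↔ k ∈ ({0, 1, 3, 4, 5, 6, 7, 10} : Finset (Fin 16)))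
    (hp₉ : R₉.p = σ₀.comp ((g ^ (3 : ℕ) : ((K : Type) ≃ₐ[ℚ] (K : Type))) : (K : Type) →+* (K : Type))) (hq₉ : R₉.p' = σ₀.comp ((g ^ (4 : ℕ) : ((K : Type) ≃ₐ[ℚ] (K : Type))) : (K : Type) →+* (K : Type)))
    (hΦ₁₀ : ∀ k : Fin 16, σ₀.comp ((g ^ (k : ℕ) : ((K : Type) ≃ₐ[ℚ] (K : Type))) : (K : Type) →+* (K : Type)) ∈ R₁₀.Φ.1 ↔ k ∈ ({0, 1, 3, 4, 5, 6, 7, 10} : Finset (Fin 16)))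
    (hp₁₀ : R₁₀.p = σ₀.comp ((g ^ (4 : ℕ) : ((K : Type) ≃ₐ[ℚ] (K : Type))) : (K : Type) →+* (K : Type))) (hq₁₀ : R₁₀.p' = σ₀.comp ((g ^ (5 : ℕ) : ((K : Type) ≃ₐ[ℚ] (K : Type))) : (K : Type) →+* (K : Type)))
    (hΦ₁₁ : ∀ k : Fin 16, σ₀.comp ((g ^ (k : ℕ) : ((K : Type) ≃ₐ[ℚ] (K : Type))) : (K : Type) →+* (K : Type)) ∈ R₁₁.Φ.1 ↔ k ∈ ({0, 1, 3, 4, 5, 6, 7, 10} : Finset (Fin 16)))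
    (hp₁₁ : R₁₁.p = σ₀.comp ((g ^ (5 : ℕ) : ((K : Type) ≃ₐ[ℚ] (K : Type))) : (K : Type) →+* (K : Type))) (hq₁₁ : R₁₁.p' = σ₀.comp ((g ^ (6 : ℕ) : ((K : Type) ≃ₐ[ℚ] (K : Type))) : (K : Type) →+* (K : Type)))
    (hΦ₁₂ : ∀ k : Fin 16, σ₀.comp ((g ^ (k : ℕ) : ((K : Type) ≃ₐ[ℚ] (K : Type))) : (K : Type) →+* (K : Type)) ∈ R₁₂.Φ.1 ↔ k ∈ ({0, 1, 2, 4, 5, 6, 7, 11} : Finset (Fin 16)))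
    (hp₁₂ : R₁₂.p = σ₀.comp ((g ^ (4 : ℕ) : ((K : Type) ≃ₐ[ℚ] (K : Type))) : (K : Type) →+* (K : Type))) (hq₁₂ : R₁₂.p' = σ₀.comp ((g ^ (7 : ℕ) : ((K : Type) ≃ₐ[ℚ] (K : Type))) : (K : Type) →+* (K : Type)))
    (hΦ₁₃ : ∀ k : Fin 16, σ₀.comp ((g ^ (k : ℕ) : ((K : Type) ≃ₐ[ℚ] (K : Type))) : (K : Type) →+* (K : Type)) ∈ R₁₃.Φ.1 ↔ k ∈ ({0, 2, 4, 5, 6, 7, 9, 11} : Finset (Fin 16)))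
    (hp₁₃ : R₁₃.p = σ₀.comp ((g ^ (6 : ℕ) : ((K : Type) ≃ₐ[ℚ] (K : Type))) : (K : Type) →+* (K : Type))) (hq₁₃ : R₁₃.p' = σ₀.comp ((g ^ (7 : ℕ) : ((K : Type) ≃ₐ[ℚ] (K : Type))) : (K : Type) →+* (K : Type)))
    (hΦ₁₄ : ∀ k : Fin 16, σ₀.comp ((g ^ (k : ℕ) : ((K : Type) ≃ₐ[ℚ] (K : Type))) : (K : Type) →+* (K : Type)) ∈ R₁₄.Φ.1 ↔ k ∈ ({0, 2, 3, 5, 6, 7, 9, 12} : Finset (Fin 16)))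
    (hp₁₄ : R₁₄.p = σ₀.comp ((g ^ (3 : ℕ) : ((K : Type) ≃ₐ[ℚ] (K : Type))) : (K : Type) →+* (K : Type))) (hq₁₄ : R₁₄.p' = σ₀.comp ((g ^ (5 : ℕ) : ((K : Type) ≃ₐ[ℚ] (K : Type))) : (K : Type) →+* (K : Type)))
    (hΦ₁₅ : ∀ k : Fin 16, σ₀.comp ((g ^ (k : ℕ) : ((K : Type) ≃ₐ[ℚ] (K : Type))) : (K : Type) →+* (K : Type)) ∈ R₁₅.Φ.1 ↔ k ∈ ({0, 2, 3, 5, 6, 7, 9, 12} : Finset (Fin 16)))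
    (hp₁₅ : R₁₅.p = σ₀.comp ((g ^ (3 : ℕ) : ((K : Type) ≃ₐ[ℚ] (K : Type))) : (K : Type) →+* (K : Type))) (hq₁₅ : R₁₅.p' = σ₀.comp ((g ^ (7 : ℕ) : ((K : Type) ≃ₐ[ℚ] (K : Type))) : (K : Type) →+* (K : Type)))
    (h₁ : ∃ ι₁ : K →+* ℂ, R₁.Admissible ι₁ ∧ ∃ (V : HermSpace3 K ι₁) (σ : K →+* ℂ),
      (Model.picardCMUniverse exists_isReal_hodgeModel_holds hodgePQ_independent_of_hodgeModel_holds
        BallQuotient.ballQuotientUniformised_holds cmAbelianVarietyRealised_holds).PeriodNV ι₁ V K R₁.psi σ)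
    (h₂ : ∃ ι₁ : K →+* ℂ, R₂.Admissible ι₁ ∧ ∃ (V : HermSpace3 K ι₁) (σ : K →+* ℂ),
      (Model.picardCMUniverse exists_isReal_hodgeModel_holds hodgePQ_independent_of_hodgeModel_holds
        BallQuotient.ballQuotientUniformised_holds cmAbelianVarietyRealised_holds).PeriodNV ι₁ V K R₂.psi σ)
    (h₃ : ∃ ι₁ : K →+* ℂ, R₃.Admissible ι₁ ∧ ∃ (V : HermSpace3 K ι₁) (σ : K →+* ℂ),
      (Model.picardCMUniverse exists_isReal_hodgeModel_holds hodgePQ_independent_of_hodgeModel_holds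
        BallQuotient.ballQuotientUniformised_holds cmAbelianVarietyRealised_holds).PeriodNV ι₁ V K R₃.psi σ)
    (h₄ : ∃ ι₁ : K →+* ℂ, R₄.Admissible ι₁ ∧ ∃ (V : HermSpace3 K ι₁) (σ : K →+* ℂ),
      (Model.picardCMUniverse exists_isReal_hodgeModel_holds hodgePQ_independent_of_hodgeModel_holds
        BallQuotient.ballQuotientUniformised_holds cmAbelianVarietyRealised_holds).PeriodNV ι₁ V K R₄.psi σ)
    (h₅ : ∃ ι₁ : K →+* ℂ, R₅.Admissible ι₁ ∧ ∃ (V : HermSpace3 K ι₁) (σ : K →+* ℂ),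
      (Model.picardCMUniverse exists_isReal_hodgeModel_holds hodgePQ_independent_of_hodgeModel_holds
        BallQuotient.ballQuotientUniformised_holds cmAbelianVarietyRealised_holds).PeriodNV ι₁ V K R₅.psi σ)
    (h₆ : ∃ ι₁ : K →+* ℂ, R₆.Admissible ι₁ ∧ ∃ (V : HermSpace3 K ι₁) (σ : K →+* ℂ),
      (Model.picardCMUniverse exists_isReal_hodgeModel_holds hodgePQ_independent_of_hodgeModel_holds
        BallQuotient.ballQuotientUniformised_holds cmAbelianVarietyRealised_holds).PeriodNV ι₁ V K R₆.psi σ)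
    (h₇ : ∃ ι₁ : K →+* ℂ, R₇.Admissible ι₁ ∧ ∃ (V : HermSpace3 K ι₁) (σ : K →+* ℂ),
      (Model.picardCMUniverse exists_isReal_hodgeModel_holds hodgePQ_independent_of_hodgeModel_holds
        BallQuotient.ballQuotientUniformised_holds cmAbelianVarietyRealised_holds).PeriodNV ι₁ V K R₇.psi σ)
    (h₈ : ∃ ι₁ : K →+* ℂ, R₈.Admissible ι₁ ∧ ∃ (V : HermSpace3 K ι₁) (σ : K →+* ℂ),
      (Model.picardCMUniverse exists_isReal_hodgeModel_holds hodgePQ_independent_of_hodgeModel_holds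
        BallQuotient.ballQuotientUniformised_holds cmAbelianVarietyRealised_holds).PeriodNV ι₁ V K R₈.psi σ)
    (h₉ : ∃ ι₁ : K →+* ℂ, R₉.Admissible ι₁ ∧ ∃ (V : HermSpace3 K ι₁) (σ : K →+* ℂ),
      (Model.picardCMUniverse exists_isReal_hodgeModel_holds hodgePQ_independent_of_hodgeModel_holds
        BallQuotient.ballQuotientUniformised_holds cmAbelianVarietyRealised_holds).PeriodNV ι₁ V K R₉.psi σ)
    (h₁₀ : ∃ ι₁ : K →+* ℂ, R₁₀.Admissible ι₁ ∧ ∃ (V : HermSpace3 K ι₁) (σ : K →+* ℂ),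
      (Model.picardCMUniverse exists_isReal_hodgeModel_holds hodgePQ_independent_of_hodgeModel_holds
        BallQuotient.ballQuotientUniformised_holds cmAbelianVarietyRealised_holds).PeriodNV ι₁ V K R₁₀.psi σ)
    (h₁₁ : ∃ ι₁ : K →+* ℂ, R₁₁.Admissible ι₁ ∧ ∃ (V : HermSpace3 K ι₁) (σ : K →+* ℂ),
      (Model.picardCMUniverse exists_isReal_hodgeModel_holds hodgePQ_independent_of_hodgeModel_holds
        BallQuotient.ballQuotientUniformised_holds cmAbelianVarietyRealised_holds).PeriodNV ι₁ V K R₁₁.psi σ)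
    (h₁₂ : ∃ ι₁ : K →+* ℂ, R₁₂.Admissible ι₁ ∧ ∃ (V : HermSpace3 K ι₁) (σ : K →+* ℂ),
      (Model.picardCMUniverse exists_isReal_hodgeModel_holds hodgePQ_independent_of_hodgeModel_holds
        BallQuotient.ballQuotientUniformised_holds cmAbelianVarietyRealised_holds).PeriodNV ι₁ V K R₁₂.psi σ)
    (h₁₃ : ∃ ι₁ : K →+* ℂ, R₁₃.Admissible ι₁ ∧ ∃ (V : HermSpace3 K ι₁) (σ : K →+* ℂ),
      (Model.picardCMUniverse exists_isReal_hodgeModel_holds hodgePQ_independent_of_hodgeModel_holds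
        BallQuotient.ballQuotientUniformised_holds cmAbelianVarietyRealised_holds).PeriodNV ι₁ V K R₁₃.psi σ)
    (h₁₄ : ∃ ι₁ : K →+* ℂ, R₁₄.Admissible ι₁ ∧ ∃ (V : HermSpace3 K ι₁) (σ : K →+* ℂ),
      (Model.picardCMUniverse exists_isReal_hodgeModel_holds hodgePQ_independent_of_hodgeModel_holds
        BallQuotient.ballQuotientUniformised_holds cmAbelianVarietyRealised_holds).PeriodNV ι₁ V K R₁₄.psi σ)
    (h₁₅ : ∃ ι₁ : K →+* ℂ, R₁₅.Admissible ι₁ ∧ ∃ (V : HermSpace3 K ι₁) (σ : K →+* ℂ),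
      (Model.picardCMUniverse exists_isReal_hodgeModel_holds hodgePQ_independent_of_hodgeModel_holds
        BallQuotient.ballQuotientUniformised_holds cmAbelianVarietyRealised_holds).PeriodNV ι₁ V K R₁₅.psi σ)
    {P A : AbelianVariety ℂ} (hP : AbelianVariety.IsProductOf (fun B : AbelianVariety ℂ =>
      ∃ (E : Type) (_ : Field E) (_ : NumberField E) (_ : IsCMField E) (_ : E →+* (K : Type)) (Φ : CMType E)
        (ι : 𝓞 E →+* End B) (θ : E →+* Module.End ℂ (complexBetti B.X 1)),
        IsCMTypeRealisation Φ B ι θ) P)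
    (hA : AVDominatedBy A P) : HodgeConjectureFor A.dim A.X := by
  have hn : Nat.card ((K : Type) ≃ₐ[ℚ] (K : Type)) = 16 := (IsGalois.card_aut_eq_finrank ℚ (K : Type)).trans hK
  obtain ⟨ε, hε, hpow, hconj⟩ := exists_autEnum_of_generator K hK hg σ₀
  obtain ⟨c, hc⟩ := FaceCensus.exists_conjAut σ₀
  refine hodgeConjectureFor_of_avDominatedBy_isProductOf_of_facePeriod_hexadecicCyclic_aut K σ₀ ε hε c hc (hconj c hc) R₁ R₂ R₃ R₄ R₅ R₆ R₇ R₈ R₉ R₁₀ R₁₁ R₁₂ R₁₃ R₁₄ R₁₅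
    (g ^ (0 : ℕ)) (g ^ (5 : ℕ)) (g ^ (1 : ℕ)) (g ^ (6 : ℕ)) (g ^ (4 : ℕ)) (g ^ (5 : ℕ)) (g ^ (2 : ℕ)) (g ^ (4 : ℕ)) (g ^ (2 : ℕ)) (g ^ (7 : ℕ)) (g ^ (4 : ℕ)) (g ^ (6 : ℕ)) (g ^ (1 : ℕ)) (g ^ (3 : ℕ)) (g ^ (1 : ℕ)) (g ^ (4 : ℕ)) (g ^ (3 : ℕ)) (g ^ (4 : ℕ)) (g ^ (4 : ℕ)) (g ^ (5 : ℕ)) (g ^ (5 : ℕ)) (g ^ (6 : ℕ)) (g ^ (4 : ℕ)) (g ^ (7 : ℕ)) (g ^ (6 : ℕ)) (g ^ (7 : ℕ)) (g ^ (3 : ℕ)) (g ^ (5 : ℕ)) (g ^ (3 : ℕ)) (g ^ (7 : ℕ))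
    ?_ ?_ ?_ ?_ ?_ ?_ ?_ ?_ ?_ ?_ ?_ ?_ ?_ ?_ ?_ ?_ ?_ ?_ ?_ ?_ ?_ ?_ ?_ ?_ ?_ ?_ ?_ ?_ ?_ ?_ ?_ ?_ ?_ ?_ ?_ ?_ ?_ ?_ ?_ ?_ ?_ ?_ ?_ ?_ ?_ ?_ ?_ ?_ ?_ ?_ ?_ ?_ ?_ ?_ ?_ ?_ ?_ ?_ ?_ ?_ ?_ ?_ ?_ ?_ ?_ ?_ ?_ ?_ ?_ ?_ ?_ ?_ ?_ ?_ ?_ h₁ h₂ h₃ h₄ h₅ h₆ h₇ h₈ h₉ h₁₀ h₁₁ h₁₂ h₁₃ h₁₄ h₁₅ hP hA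
  · intro x
    obtain ⟨k, rfl⟩ := FaceCensus.exists_pow_eq_of_generator hg hn x
    rw [hpow, mem_255_iff]
    exact hΦ₁ k
  · exact hp₁
  · rw [show (0 : ℕ) = ((0 : Fin 16) : ℕ) from rfl, hpow]; decide
  · exact hq₁
  · rw [show (5 : ℕ) = ((5 : Fin 16) : ℕ) from rfl, hpow]; decide
  · intro x
    obtain ⟨k, rfl⟩ := FaceCensus.exists_pow_eq_of_generator hg hn x
    rw [hpow, mem_255_iff]
    exact hΦ₂ k
  · exact hp₂
  · rw [show (1 : ℕ) = ((1 : Fin 16) : ℕ) from rfl, hpow]; decide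
  · exact hq₂
  · rw [show (6 : ℕ) = ((6 : Fin 16) : ℕ) from rfl, hpow]; decide
  · intro x
    obtain ⟨k, rfl⟩ := FaceCensus.exists_pow_eq_of_generator hg hn x
    rw [hpow, mem_255_iff]
    exact hΦ₃ k
  · exact hp₃
  · rw [show (4 : ℕ) = ((4 : Fin 16) : ℕ) from rfl, hpow]; decide
  · exact hq₃
  · rw [show (5 : ℕ) = ((5 : Fin 16) : ℕ) from rfl, hpow]; decide
  · intro x
    obtain ⟨k, rfl⟩ := FaceCensus.exists_pow_eq_of_generator hg hn x
    rw [hpow, mem_765_iff]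
    exact hΦ₄ k
  · exact hp₄
  · rw [show (2 : ℕ) = ((2 : Fin 16) : ℕ) from rfl, hpow]; decide
  · exact hq₄
  · rw [show (4 : ℕ) = ((4 : Fin 16) : ℕ) from rfl, hpow]; decide
  · intro x
    obtain ⟨k, rfl⟩ := FaceCensus.exists_pow_eq_of_generator hg hn x
    rw [hpow, mem_765_iff]
    exact hΦ₅ k
  · exact hp₅
  · rw [show (2 : ℕ) = ((2 : Fin 16) : ℕ) from rfl, hpow]; decide
  · exact hq₅
  · rw [show (7 : ℕ) = ((7 : Fin 16) : ℕ) from rfl, hpow]; decide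
  · intro x
    obtain ⟨k, rfl⟩ := FaceCensus.exists_pow_eq_of_generator hg hn x
    rw [hpow, mem_765_iff]
    exact hΦ₆ k
  · exact hp₆
  · rw [show (4 : ℕ) = ((4 : Fin 16) : ℕ) from rfl, hpow]; decide
  · exact hq₆
  · rw [show (6 : ℕ) = ((6 : Fin 16) : ℕ) from rfl, hpow]; decide
  · intro x
    obtain ⟨k, rfl⟩ := FaceCensus.exists_pow_eq_of_generator hg hn x
    rw [hpow, mem_1275_iff]
    exact hΦ₇ k
  · exact hp₇
  · rw [show (1 : ℕ) = ((1 : Fin 16) : ℕ) from rfl, hpow]; decide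
  · exact hq₇
  · rw [show (3 : ℕ) = ((3 : Fin 16) : ℕ) from rfl, hpow]; decide
  · intro x
    obtain ⟨k, rfl⟩ := FaceCensus.exists_pow_eq_of_generator hg hn x
    rw [hpow, mem_1275_iff]
    exact hΦ₈ k
  · exact hp₈
  · rw [show (1 : ℕ) = ((1 : Fin 16) : ℕ) from rfl, hpow]; decide
  · exact hq₈
  · rw [show (4 : ℕ) = ((4 : Fin 16) : ℕ) from rfl, hpow]; decide
  · intro x
    obtain ⟨k, rfl⟩ := FaceCensus.exists_pow_eq_of_generator hg hn x
    rw [hpow, mem_1275_iff]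
    exact hΦ₉ k
  · exact hp₉
  · rw [show (3 : ℕ) = ((3 : Fin 16) : ℕ) from rfl, hpow]; decide
  · exact hq₉
  · rw [show (4 : ℕ) = ((4 : Fin 16) : ℕ) from rfl, hpow]; decide
  · intro x
    obtain ⟨k, rfl⟩ := FaceCensus.exists_pow_eq_of_generator hg hn x
    rw [hpow, mem_1275_iff]
    exact hΦ₁₀ k
  · exact hp₁₀
  · rw [show (4 : ℕ) = ((4 : Fin 16) : ℕ) from rfl, hpow]; decide
  · exact hq₁₀
  · rw [show (5 : ℕ) = ((5 : Fin 16) : ℕ) from rfl, hpow]; decide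
  · intro x
    obtain ⟨k, rfl⟩ := FaceCensus.exists_pow_eq_of_generator hg hn x
    rw [hpow, mem_1275_iff]
    exact hΦ₁₁ k
  · exact hp₁₁
  · rw [show (5 : ℕ) = ((5 : Fin 16) : ℕ) from rfl, hpow]; decide
  · exact hq₁₁
  · rw [show (6 : ℕ) = ((6 : Fin 16) : ℕ) from rfl, hpow]; decide
  · intro x
    obtain ⟨k, rfl⟩ := FaceCensus.exists_pow_eq_of_generator hg hn x
    rw [hpow, mem_2295_iff]
    exact hΦ₁₂ k
  · exact hp₁₂
  · rw [show (4 : ℕ) = ((4 : Fin 16) : ℕ) from rfl, hpow]; decide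
  · exact hq₁₂
  · rw [show (7 : ℕ) = ((7 : Fin 16) : ℕ) from rfl, hpow]; decide
  · intro x
    obtain ⟨k, rfl⟩ := FaceCensus.exists_pow_eq_of_generator hg hn x
    rw [hpow, mem_2805_iff]
    exact hΦ₁₃ k
  · exact hp₁₃
  · rw [show (6 : ℕ) = ((6 : Fin 16) : ℕ) from rfl, hpow]; decide
  · exact hq₁₃
  · rw [show (7 : ℕ) = ((7 : Fin 16) : ℕ) from rfl, hpow]; decide
  · intro x
    obtain ⟨k, rfl⟩ := FaceCensus.exists_pow_eq_of_generator hg hn x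
    rw [hpow, mem_4845_iff]
    exact hΦ₁₄ k
  · exact hp₁₄
  · rw [show (3 : ℕ) = ((3 : Fin 16) : ℕ) from rfl, hpow]; decide
  · exact hq₁₄
  · rw [show (5 : ℕ) = ((5 : Fin 16) : ℕ) from rfl, hpow]; decide
  · intro x
    obtain ⟨k, rfl⟩ := FaceCensus.exists_pow_eq_of_generator hg hn x
    rw [hpow, mem_4845_iff]
    exact hΦ₁₅ k
  · exact hp₁₅
  · rw [show (3 : ℕ) = ((3 : Fin 16) : ℕ) from rfl, hpow]; decide
  · exact hq₁₅
  · rw [show (7 : ℕ) = ((7 : Fin 16) : ℕ) from rfl, hpow]; decide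

end Summit.HodgeConjecture.CorCM.HexadecicFaceTransport.Cyclic

end
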